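import Summits.BirchSwinnertonDyer.BirchSwinnertonDyer.Theorems.GenusKolyvaginAtTwoGenusDeepSupplyAtTwoNegDiscNarrowDepthZeroInstance
import Summits.BirchSwinnertonDyer.BirchSwinnertonDyer.Theorems.GenusKolyvaginAtTwoGenusDeepSupplyAtTwoNegDiscNarrowStubCSplit
import HarnessLib

/-!
# Route `GenusKolyvaginAtTwo`, crux 23491 `GenusDeepSupplyAtTwoNegDiscNarrow`, registered stub C‴ on the `#Sel₂(E) = 1` cell:
# K₁ ⟸ ONE REDUCTION BIT R₁ — the deciding Δ<0 crux from FIVE ROUTE ITEMS + R₁ + K₄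

Seat `bsd-line-gk2-p5` g33 (cell `bsd-f1-sign2`, WIDTH-5 attach), `--supports stmt-BirchSwinnertonDyer-23491 --as helper`.
THEOREMS ONLY (no definition, no named fact, no `sorry`).  **BSD is NOT proved by this file and no item is closed by it; CONDITIONAL
(the hypotheses R₁ and K₄ are beyond print); the registered stub C‴ is untouched.**

The LEAD's split `stubC_negDisc_of_selmerSplit` (p762183) writes the registered stub C‴ of the Δ<0 supply crux as K₁ ∧ K₄, K₁ = «on the
`#Sel₂(E) = 1` cell the C‴-frame with `1 ≤ M₀` is contradictory» (Kolyvagin's conjecture, BASE CASE at `p = 2`).  The depth-zero reduction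
criterion (kernel p761607, instantiated in `…DepthZeroInertia` / `…DepthZeroInstance`: `DepthZero.depth_eq_zero_of_geomReduction_ne`) turns K₁
into ONE BIT OF ONE REDUCTION:

**R₁** := on the `#Sel₂(E) = 1` cell of the habitat, for every (H2)-admissible Heegner field `K` (odd `d_K ≠ −3`, the two Theorem-B non-squares),
every odd-Manin datum and conductor-`1` Kolyvagin–Heegner datum `d₁` with `y_K = P(1)` of infinite order, and the narrow twin: there is a prime
`ℓ ∣ d_K` of good reduction and a `K`-rational lift `P₀ ↦ P(1)` whose reduction at the tree's place of `ℚ̄` over `ℓ` is NOT the reduction of any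
`Aut(K/ℚ)`-fixed torsion point of `E(K)` («`y_K ≢` rational torsion mod `𝔓 ∣ ℓ`»; for `E(ℚ)_tors = 0`: `y_K ≢ Õ`).  Memo
`DEPTH-ZERO-REDUCTION-CRITERION-g21.md` §2 Claim B / §3 instrument I1: on this cell BSD predicts R₁ at every prime Heegner field of the supply;
R₁ is the input shape of a RAMIFIED Jochnowitz congruence — still beyond print.

* `K1_of_reductionBit : R₁ → K₁` (`depth_eq_zero_of_geomReduction_ne` contradicts `1 ≤ M₀`);
* `genusDeepSupplyAtTwoNegDiscNarrow_of_items_of_reductionBit : GrossZagierAllLevels → ModularityExistsNewform → TwoParityDD →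
  RankOneTwoConverse → RankOneTwoConverseOffSemistableAtTwo → R₁ → K₄ → GenusDeepSupplyAtTwoNegDiscNarrow` — the DECIDING Δ<0 crux BY NAME.

References: [GrossLMS1991] §5 Prop. 5.3, §4 (4.1), Lemma 4.3; [McCallumLMS1991] §5 Lemma 5.1; [WZhang2014] Thm. 9.3 (base case, `p ≥ 5`);
[BertoliniDarmon1999] (Jochnowitz congruences); [Serre1972] §1.11 Prop. 11.
-/

set_option autoImplicit false
set_option linter.dupNamespace false -- `Summit.<P>.<Sub>` repeats `BirchSwinnertonDyer` (D-0017)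

noncomputable section

open scoped Classical NumberField Pointwise

namespace Summit.BirchSwinnertonDyer.BirchSwinnertonDyer.Theorems.GenusSupplyNarrow.DepthZero

open IsDedekindDomain Field NumberField WeierstrassCurve Literature.NumberTheory.EllipticCurves
  Literature.NumberTheory.EllipticCurves.ModularForms Literature.NumberTheory.GaloisRepresentations Rat.HeightOneSpectrum
  Summit.BirchSwinnertonDyer.BirchSwinnertonDyer.Theses.GenusKolyvaginAtTwo
  Summit.BirchSwinnertonDyer.BirchSwinnertonDyer.Theorems.GenusSupplyNarrow

/-- **K₁ ⟸ R₁: on the `#Sel₂(E) = 1` cell, ONE REDUCTION BIT decides the registered stub.**  If for every frame of the cell some good prime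
`ℓ ∣ d_K` and some lift `P₀ ↦ P(1) = y_K` have `red_ℓ(e_* P₀) ∉ red_ℓ(e_*(E(K)_tors^{Aut(K/ℚ)}))` (hypothesis `hR` = R₁), then the C‴-frame with
`1 ≤ M₀` is contradictory there (K₁ in the shape of `stubC_negDisc_of_selmerSplit`): `depth_eq_zero_of_geomReduction_ne` gives `M₀ = 0`
(`ρ̄_{E,2}` onto from the habitat at `n = 1`; `d_K·Δ ∉ ℚ²` is the crux's first Theorem-B clause since `Δ < 0`).  CONDITIONAL on R₁.
[cite: GrossLMS1991, §5 Prop. 5.3, §4 (4.1), Lemma 4.3] [cite: McCallumLMS1991, §5 Lemma 5.1] -/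
theorem K1_of_reductionBit
    (hR : ∀ (W : WeierstrassCurve ℚ) [W.IsElliptic] [W.IsGloballyMinimal] [NeZero (W.conductorNorm ℤ)],
      ¬ W.HasCM → W.analyticRank = 0 → (∀ n : ℕ, 0 < n → W.HasSurjectiveModNGaloisRep ((2 : ℤ) ^ n)) →
      Odd W.tamagawaProduct → W.Δ < 0 → Nat.card (W.selmerGroup 2) = 1 →
      ∀ (K : Type) [Field K] [NumberField K],
      IsImaginaryQuadratic K → Odd (NumberField.discr K) → NumberField.discr K ≠ -3 →
      SatisfiesHeegnerHypothesis (W.conductorNorm ℤ) K →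
      ¬ IsSquare ((NumberField.discr K : ℚ) * -|W.Δ|) → ¬ IsSquare ((NumberField.discr K : ℚ) * (-(2 * |W.Δ|))) →
      ∀ (Dt : ModularParametrizationData W (W.conductorNorm ℤ)),
      (∀ z ∈ Dt.L.lattice, ∃ w ∈ periodLattice Dt.f, z = (Dt.c : ℂ) * w) → Odd Dt.c →
      ∀ (β : ℤ) (ι : K →+* ℂ) (d₁ : KolyvaginHeegnerData Dt β ι 1), ¬ IsOfFinAddOrder d₁.derivedPoint →
      ∀ (Wd : WeierstrassCurve ℚ) [Wd.IsElliptic] [Wd.IsGloballyMinimal],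
      (∃ C : WeierstrassCurve.VariableChange ℚ, C • W.quadraticTwist (NumberField.discr K : ℚ) = Wd) →
      Wd.analyticRank = 1 → Nat.card (Wd.selmerGroup 2) = 2 → padicValNat 2 Wd.tamagawaProduct ≤ 1 →
      ∃ (ℓ : ℕ) (_ : Fact ℓ.Prime) (_ : (ℓ : ℤ) ∣ NumberField.discr K) (hΔ : ¬ (ℓ : ℤ) ∣ minimalDiscriminantInt W)
        (P₀ : (W.baseChange K).toAffine.Point),
        Affine.Point.map (W' := W) (algebraMap K (ringClassField K ι 1)).toRatAlgHom P₀ = d₁.derivedPoint ∧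
        ∀ s : (W.baseChange K).toAffine.Point, IsOfFinAddOrder s → (∀ σ : K ≃ₐ[ℚ] K, σ • s = s) →
          geomReduction hΔ (Affine.Point.map (W' := W) (absEmbedding ℚ K) P₀ : W.geomPoints) ≠
            geomReduction hΔ (Affine.Point.map (W' := W) (absEmbedding ℚ K) s : W.geomPoints)) :
    ∀ (W : WeierstrassCurve ℚ) [W.IsElliptic] [W.IsGloballyMinimal] [NeZero (W.conductorNorm ℤ)],
      ¬ W.HasCM → W.analyticRank = 0 → (∀ n : ℕ, 0 < n → W.HasSurjectiveModNGaloisRep ((2 : ℤ) ^ n)) →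
      Odd W.tamagawaProduct → W.Δ < 0 → Nat.card (W.selmerGroup 2) = 1 →
      ∀ (K : Type) [Field K] [NumberField K],
      IsImaginaryQuadratic K → Odd (NumberField.discr K) → NumberField.discr K ≠ -3 →
      SatisfiesHeegnerHypothesis (W.conductorNorm ℤ) K →
      ¬ IsSquare ((NumberField.discr K : ℚ) * -|W.Δ|) → ¬ IsSquare ((NumberField.discr K : ℚ) * (-(2 * |W.Δ|))) →
      ∀ (Dt : ModularParametrizationData W (W.conductorNorm ℤ)),
      (∀ z ∈ Dt.L.lattice, ∃ w ∈ periodLattice Dt.f, z = (Dt.c : ℂ) * w) → Odd Dt.c →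
      ∀ (β : ℤ) (ι : K →+* ℂ) (d₁ : KolyvaginHeegnerData Dt β ι 1), ¬ IsOfFinAddOrder d₁.derivedPoint →
      ∀ (M₀ : ℕ), (∃ Q : (W.baseChange (ringClassField K ι 1)).toAffine.Point, ((2 ^ M₀ : ℕ) : ℤ) • Q = d₁.derivedPoint) →
      (¬ ∃ Q : (W.baseChange (ringClassField K ι 1)).toAffine.Point, ((2 ^ (M₀ + 1) : ℕ) : ℤ) • Q = d₁.derivedPoint) →
      1 ≤ M₀ →
      ∀ (Wd : WeierstrassCurve ℚ) [Wd.IsElliptic] [Wd.IsGloballyMinimal],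
      (∃ C : WeierstrassCurve.VariableChange ℚ, C • W.quadraticTwist (NumberField.discr K : ℚ) = Wd) →
      Wd.analyticRank = 1 → Nat.card (Wd.selmerGroup 2) = 2 → padicValNat 2 Wd.tamagawaProduct ≤ 1 →
      False := by
  intro W _ _ _ hcm hr0 hρ hT hneg h1 K _ _ hIQ hodd h3 hHe hsq1 hsq2 Dt hoptDt hc β ι d₁ hy M₀ hdiv _hndiv hM Wd _ _ hWd hrd hSel hDEF
  obtain ⟨ℓ, hℓp, hℓ, hΔ, P₀, hP₀, hred⟩ :=
    hR W hcm hr0 hρ hT hneg h1 K hIQ hodd h3 hHe hsq1 hsq2 Dt hoptDt hc β ι d₁ hy Wd hWd hrd hSel hDEF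
  have hρ2 : W.HasSurjectiveModNGaloisRep 2 := by simpa using hρ 1 one_pos
  have hsq : ¬ IsSquare ((NumberField.discr K : ℚ) * W.Δ) := by
    rwa [show -|W.Δ| = W.Δ by rw [abs_of_neg hneg, neg_neg]] at hsq1
  have hM0 : M₀ = 0 := depth_eq_zero_of_geomReduction_ne W hIQ hHe hr0 hρ2 hsq hℓ hΔ Dt β ι d₁ hP₀ hred hdiv
  omega

/-- **THE DECIDING Δ<0 CRUX FROM FIVE ROUTE ITEMS + THE REDUCTION BIT R₁ + K₄** (`genusDeepSupplyAtTwoNegDiscNarrow_of_items_of_selmerSplit` ∘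
`K1_of_reductionBit`): on the `#Sel₂(E) = 1` cell the beyond-print input is one reduction of `y_K` at a ramified good prime, on the
`#Sel₂(E) = 4` cell it is K₄ (deep `2`-primitivity at positive depth).  CONDITIONAL on R₁, K₄ and the two declared rank-one `2`-converse
items; prints `GrossZagierAllLevels`, `ModularityExistsNewform`, `TwoParityDD`.  BSD is NOT proved by this.
[cite: GrossZagier1986, Thm. I.6.3 with V.§2] [cite: GrossLMS1991, §3 (3.5), §4 (4.1), §5 Prop. 5.3] [cite: McCallumLMS1991, §5 Lemma 5.1] -/
theorem genusDeepSupplyAtTwoNegDiscNarrow_of_items_of_reductionBit (hGZ : GrossZagierAllLevels) (hmod : ModularityExistsNewform)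
    (hpar : TwoParityDD) (hconv : RankOneTwoConverse) (hconv' : RankOneTwoConverseOffSemistableAtTwo)
    (hR : ∀ (W : WeierstrassCurve ℚ) [W.IsElliptic] [W.IsGloballyMinimal] [NeZero (W.conductorNorm ℤ)],
      ¬ W.HasCM → W.analyticRank = 0 → (∀ n : ℕ, 0 < n → W.HasSurjectiveModNGaloisRep ((2 : ℤ) ^ n)) →
      Odd W.tamagawaProduct → W.Δ < 0 → Nat.card (W.selmerGroup 2) = 1 →
      ∀ (K : Type) [Field K] [NumberField K],
      IsImaginaryQuadratic K → Odd (NumberField.discr K) → NumberField.discr K ≠ -3 →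
      SatisfiesHeegnerHypothesis (W.conductorNorm ℤ) K →
      ¬ IsSquare ((NumberField.discr K : ℚ) * -|W.Δ|) → ¬ IsSquare ((NumberField.discr K : ℚ) * (-(2 * |W.Δ|))) →
      ∀ (Dt : ModularParametrizationData W (W.conductorNorm ℤ)),
      (∀ z ∈ Dt.L.lattice, ∃ w ∈ periodLattice Dt.f, z = (Dt.c : ℂ) * w) → Odd Dt.c →
      ∀ (β : ℤ) (ι : K →+* ℂ) (d₁ : KolyvaginHeegnerData Dt β ι 1), ¬ IsOfFinAddOrder d₁.derivedPoint →
      ∀ (Wd : WeierstrassCurve ℚ) [Wd.IsElliptic] [Wd.IsGloballyMinimal],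
      (∃ C : WeierstrassCurve.VariableChange ℚ, C • W.quadraticTwist (NumberField.discr K : ℚ) = Wd) →
      Wd.analyticRank = 1 → Nat.card (Wd.selmerGroup 2) = 2 → padicValNat 2 Wd.tamagawaProduct ≤ 1 →
      ∃ (ℓ : ℕ) (_ : Fact ℓ.Prime) (_ : (ℓ : ℤ) ∣ NumberField.discr K) (hΔ : ¬ (ℓ : ℤ) ∣ minimalDiscriminantInt W)
        (P₀ : (W.baseChange K).toAffine.Point),
        Affine.Point.map (W' := W) (algebraMap K (ringClassField K ι 1)).toRatAlgHom P₀ = d₁.derivedPoint ∧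
        ∀ s : (W.baseChange K).toAffine.Point, IsOfFinAddOrder s → (∀ σ : K ≃ₐ[ℚ] K, σ • s = s) →
          geomReduction hΔ (Affine.Point.map (W' := W) (absEmbedding ℚ K) P₀ : W.geomPoints) ≠
            geomReduction hΔ (Affine.Point.map (W' := W) (absEmbedding ℚ K) s : W.geomPoints))
    (hK4 : ∀ (W : WeierstrassCurve ℚ) [W.IsElliptic] [W.IsGloballyMinimal] [NeZero (W.conductorNorm ℤ)],
      ¬ W.HasCM → W.analyticRank = 0 → (∀ n : ℕ, 0 < n → W.HasSurjectiveModNGaloisRep ((2 : ℤ) ^ n)) →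
      Odd W.tamagawaProduct → W.Δ < 0 → Nat.card (W.selmerGroup 2) = 4 →
      ∀ (K : Type) [Field K] [NumberField K],
      IsImaginaryQuadratic K → Odd (NumberField.discr K) → NumberField.discr K ≠ -3 →
      SatisfiesHeegnerHypothesis (W.conductorNorm ℤ) K →
      ¬ IsSquare ((NumberField.discr K : ℚ) * -|W.Δ|) → ¬ IsSquare ((NumberField.discr K : ℚ) * (-(2 * |W.Δ|))) →
      ∀ (Dt : ModularParametrizationData W (W.conductorNorm ℤ)),
      (∀ z ∈ Dt.L.lattice, ∃ w ∈ periodLattice Dt.f, z = (Dt.c : ℂ) * w) → Odd Dt.c →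
      ∀ (β : ℤ) (ι : K →+* ℂ) (d₁ : KolyvaginHeegnerData Dt β ι 1), ¬ IsOfFinAddOrder d₁.derivedPoint →
      ∀ (M₀ : ℕ), (∃ Q : (W.baseChange (ringClassField K ι 1)).toAffine.Point, ((2 ^ M₀ : ℕ) : ℤ) • Q = d₁.derivedPoint) →
      (¬ ∃ Q : (W.baseChange (ringClassField K ι 1)).toAffine.Point, ((2 ^ (M₀ + 1) : ℕ) : ℤ) • Q = d₁.derivedPoint) →
      1 ≤ M₀ →
      ∀ (Wd : WeierstrassCurve ℚ) [Wd.IsElliptic] [Wd.IsGloballyMinimal],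
      (∃ C : WeierstrassCurve.VariableChange ℚ, C • W.quadraticTwist (NumberField.discr K : ℚ) = Wd) →
      Wd.analyticRank = 1 → Nat.card (Wd.selmerGroup 2) = 2 → padicValNat 2 Wd.tamagawaProduct ≤ 1 →
      ∃ (n : ℕ) (d : KolyvaginHeegnerData Dt β ι n), Squarefree n ∧
        (∀ ℓ ∈ n.primeFactors, Zhang2014.IsKolyvaginPrime (W.conductorNorm ℤ) W K 2 ℓ ∧ 2 ≤ Zhang2014.kolyvaginIndex W 2 ℓ ∧
          FrobEqFrobInfty W K 2 ℓ) ∧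
        ¬ ∃ Q : (W.baseChange (ringClassField K ι n)).toAffine.Point, (2 : ℤ) • Q = d.derivedPoint) :
    GenusDeepSupplyAtTwoNegDiscNarrow :=
  genusDeepSupplyAtTwoNegDiscNarrow_of_items_of_selmerSplit hGZ hmod hpar hconv hconv' (K1_of_reductionBit hR) hK4

end Summit.BirchSwinnertonDyer.BirchSwinnertonDyer.Theorems.GenusSupplyNarrow.DepthZero

end
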